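import Summits.QuantumFields.YangMills.Theorems.BalabanUVNodesN21RegularityTransferJunction
import Literature.MathematicalPhysics.QuantumFieldTheory.Balaban1983to89.Node00.LargeFieldBackgroundOfRecord

/-!
# YM-DAG node N21 (= NE7c) — file 1's δ-LINEAR REGULARITY TRANSFER read at NODE 00's (2.12) BACKGROUND OF RECORD `Node00.UbgOfRecord`
# (def-R FILE 13, p447553: `U_k(s)(𝐖)` along a (2.18) sequence `s`, class `regLFOfRecord = bgReg(ν.εreg)`) in the NO-LARGE-FIELD case
# `Ω_j(s) = T` (`1 ≤ j ≤ k`), where the record's problem IS the one-scale problem (`LargeFieldBackgroundOfRecord` §3): the object the lens card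
# C3 (`ym-lens-BalabanUVNodes-nearmiss`, pub-ymgap INBOX l.12463) reads — its «missing leaf = δ-linear minimiser regularity [15] Thm 1» supplied
# modulo N07's Theorem-1 slot, by two doors

Track A of `YM-PLAN.md` (cell `pub-ymgap`, HUMAN RULING D-0062), node **N21**, fan-out row s1; seat `pub-ymgap-dag-n21-c`, generation 0, file 3.
Kernel bookkeeping BY NAME over LANDED modules only: file 1 `BalabanUVNodesN21RegularityTransferJunction` (p454585: `plaqSmall_minimiser_of_thm1_objects`,
`plaqSmall_Uk_of_thm1_objects`, `plaqSmall_of_orbitRel`, `eta_pos`, `two_mul_N_pos`) and def-R's `Node00/LargeFieldBackgroundOfRecord` (p447553: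
`UbgOfRecord`, `isBackground_UbgOfRecord_of_top`, `orbitRel_UbgOfRecord_Uk_of_top`, `mem_solvableDom_top_iff_ukExists`, `UbgOfRecord_of_not_mem`).
0 `def`, 0 `sorry`, standard axioms.  COUNT-NEUTRAL; `--supports` the K3 item `SpineGivenEndpointR11`.

WHAT IS PROVED ([folklore] compositions; member `(K, k)`, `1 ≤ k`, a sequence of record `s : SeqOfRecord F ν M g K k` with `s.Ω j = T` for
`1 ≤ j ≤ k`, multi-scale datum `𝐖 : MSField`, `η_k := (F.P K).eta k`; N07's Theorem-1 slot `hT1` at the member = file 1's displayed hypothesis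
VERBATIM, the class radius being the record's letter `ν.εreg`).
* §1 DOOR A (F7-type): `plaqSmall_UbgOfRecord_top_of_thm1_objects` — if `𝐖` is solvable and `U_k(s)(𝐖)` lies in [B11] (2)'s space at `ν.εreg`
  (G₈a-3-type reading for the record's background, displayed), then for `δ`-regular `𝐖_k` (`0 < δ ≤ a₁`, `B₃δ ≤ ν.εreg ≤ a₀`):
  `|U_k(s)(𝐖)(∂p) − 1| < B₃·δ·η_k²` for every plaquette — δ-LINEAR, the threshold freely lowered.
* §2 DOOR B (uniqueness): `plaqSmall_UbgOfRecord_top_of_uniqueUkOrbit` — under ₈a's rows for regular data (file 1's `hUk` at `ε₀ := ν.εreg`) and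
  the named uniqueness clause `Node00.UniqueUkOrbit` (G₈a-2) at the datum, the same conclusion, transported from ₈a's `U_k(𝐖_k)` along
  `orbitRel_UbgOfRecord_Uk_of_top` (plaquette smallness is orbit-constant).
* §3 THE (2.17)-TYPE LARGE-FIELD SIDE AT THE RECORD's BACKGROUND: `mem_solvableDom_of_large_plaquette` (a `θ > 0`-large plaquette of
  `U_k(s)(𝐖)` excludes the junk branch: `𝐖` is solvable), `exists_large_plaquette_of_UbgOfRecord_dev_ge` (door A: a `θ`-large background plaquette
  forces a `B₃⁻¹η_k⁻²θ`-large plaquette of the datum `𝐖_k`, for `B₃⁻¹η_k⁻²θ ≤ min a₁ (ν.εreg∕B₃)`), `exp_neg_wilsonLoc_le_of_UbgOfRecord_dev_ge`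
  (*«estimating in the usual way the Wilson action»*, `G = SU(N)`: `e^{−A(ζ,𝐖_k)} ≤ e^{−w(2N)⁻¹(B₃⁻¹η_k⁻²θ)²}`).

HONEST FRAMING.  Count-neutral junction by name; nothing of Bałaban's asserted — N07's Theorem-1 slot (levels `k ≥ 1` = Bałaban's theorem, proved
nowhere in the tree), the (2)-space reading of the record's background resp. ₈a's rows + `UniqueUkOrbit`, stay DISPLAYED.  SCOPE: the NO-LARGE-FIELD
sequences only (`Ω_j = T`) — for a general sequence the record's (2.12) problem is multi-scale and its Theorem-1 carrier is not yet read at objects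
(file 1's located scope; the junction is verbatim when it is).  No vacuity guard at the trivial level is possible here (`1 ≤ k` is the junction's
range; the SHAPE's inhabitation at `k = 0` is file 1 §4).  (M1) ∕ `ShellWeightBound` untouched; NE7c NOT PRINTED and NOT PROVED; one finite
four-torus at fixed `ε`; nothing continuum ∕ ℝ⁴ ∕ OS ∕ mass-gap ∕ Clay.
-/

set_option autoImplicit false

noncomputable section

namespace Summit.QuantumFields.YangMills.Theorems.N21RegularityTransferAtRecord

open Literature.MathematicalPhysics.QuantumFieldTheory.Balaban1983to89
open T4Continuum (T4Family)
open B12GaugeOrbits021 (OrbitRel)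
open Node00 (SU avOfRecord bgReg InUkClassB11 UkExists Uk UniqueUkOrbit Stage7Numerics SeqOfRecord UbgOfRecord regLFOfRecord
  solvableDom isBackground_UbgOfRecord_of_top orbitRel_UbgOfRecord_Uk_of_top mem_solvableDom_top_iff_ukExists UbgOfRecord_of_not_mem)
open B15DeterminingSets (genSet MSField)
open B11Thm1CarrierT (isBackground_of_subset_of_mem)
open GaugeField (plaqHol)
open B16Sect1Wilson (wilsonLoc)
open B15Chi175LargeFieldFactor (hcmp_specialUnitaryGroup exp_neg_wilsonLoc_le_of_large_plaquette)
open N21RegularityTransferJunction (eta_pos two_mul_N_pos plaqSmall_of_orbitRel plaqSmall_minimiser_of_thm1_objects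
  plaqSmall_Uk_of_thm1_objects)

variable {F : T4Family} {N : ℕ} [NeZero N]

section Thm1Objects

variable {K k : ℕ} {a₀ a₁ B₃ : ℝ}

/- N07's THEOREM-1 SLOT AT OBJECTS for the member `(K, k)` — file 1's displayed hypothesis VERBATIM. -/
variable (hT1 : ∀ ε₁ : ℝ, 0 < ε₁ → ε₁ ≤ a₁ → ∀ V : GaugeField (F.P K) k (SU N), PlaqSmall ε₁ V →
    (∃ U : GaugeField (F.P K) 0 (SU N),
        IsBackground (avOfRecord F N K) {U | InUkClassB11 F N K k (B₃ * ε₁) U} k V U) ∧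
    (∀ ε₀ : ℝ, B₃ * ε₁ ≤ ε₀ → ε₀ ≤ a₀ → ∀ U U' : GaugeField (F.P K) 0 (SU N),
        IsBackground (avOfRecord F N K) {U | InUkClassB11 F N K k (B₃ * ε₁) U} k V U →
        IsBackground (avOfRecord F N K) {U | InUkClassB11 F N K k ε₀ U} k V U' →
          InUkClassB11 F N K k ε₀ U ∧ OrbitRel k U U'))

include hT1

/-! ## §1. Door A: the record's background read in [B11] (2)'s space -/

/-- **THE δ-LINEAR TRANSFER AT THE (2.12) BACKGROUND OF RECORD, NO-LARGE-FIELD CASE — DOOR A.**  For a sequence of record with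
`Ω_j = T` (`1 ≤ j ≤ k`), a solvable multi-scale datum `𝐖` whose background of record `U_k(s)(𝐖)` lies in [B11] (2)'s space at the record's
class radius `ν.εreg` (displayed, G₈a-3 TYPE), and `δ`-regular `𝐖_k` with `0 < δ ≤ a₁`, `B₃δ ≤ ν.εreg ≤ a₀`: `|U_k(s)(𝐖)(∂p) − 1| < B₃·δ·η_k²`
for every plaquette (`isBackground_UbgOfRecord_of_top` + F7 `isBackground_of_subset_of_mem` + file 1's transfer). [folklore] -/
theorem plaqSmall_UbgOfRecord_top_of_thm1_objects (ν : Stage7Numerics) (M : ℕ) (g : ℕ → ℝ) (hk : 1 ≤ k)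
    (s : SeqOfRecord F ν M g K k) (hs : ∀ j, 1 ≤ j → j ≤ k → s.Ω j = Set.univ) {Wms : MSField (F.P K) (SU N)}
    (hWms : Wms ∈ solvableDom (avOfRecord F N K) (regLFOfRecord F N ν K k) (genSet s.Ω k))
    (hB11 : InUkClassB11 F N K k ν.εreg (UbgOfRecord F N ν M g K k s Wms)) (hhi : ν.εreg ≤ a₀) {δ : ℝ} (hδ : 0 < δ)
    (hδa : δ ≤ a₁) (hδε : B₃ * δ ≤ ν.εreg) (hreg : PlaqSmall δ (Wms k)) :
    PlaqSmall (B₃ * δ * (F.P K).eta k ^ 2) (UbgOfRecord F N ν M g K k s Wms) :=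
  plaqSmall_minimiser_of_thm1_objects hT1 hδ hδa hδε hhi hreg
    (isBackground_of_subset_of_mem (isBackground_UbgOfRecord_of_top ν M g K k hk s hs hWms)
      (fun _ hU => Node00.InUkClassB11.mem_bgReg hU) hB11)

/-! ## §2. Door B: ₈a's rows + the named uniqueness clause -/

/-- **DOOR B — VIA ₈a's `U_k(𝐖_k)` AND `UniqueUkOrbit`.**  Under ₈a's rows for regular data at `ε₀ := ν.εreg` (file 1's `hUk`) and the named
uniqueness clause `Node00.UniqueUkOrbit F N K k ν.εreg (𝐖 k)` (G₈a-2, [B11] Thm 1 — displayed), the background of record `U_k(s)(𝐖)` of a solvable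
datum lies in one residual orbit with ₈a's `U_k(𝐖_k)` (`orbitRel_UbgOfRecord_Uk_of_top`), so file 1's transfer for `U_k` carries over: `|U_k(s)(𝐖)(∂p) −
1| < B₃·δ·η_k²`. [folklore] -/
theorem plaqSmall_UbgOfRecord_top_of_uniqueUkOrbit (ν : Stage7Numerics) (M : ℕ) (g : ℕ → ℝ) (hk : 1 ≤ k)
    (s : SeqOfRecord F ν M g K k) (hs : ∀ j, 1 ≤ j → j ≤ k → s.Ω j = Set.univ)
    (hUk : ∀ (V : GaugeField (F.P K) k (SU N)) (δ : ℝ), 0 < δ → δ ≤ a₁ → B₃ * δ ≤ ν.εreg → PlaqSmall δ V →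
      UkExists F N K k ν.εreg V ∧ InUkClassB11 F N K k ν.εreg (Uk F N K k ν.εreg V))
    {Wms : MSField (F.P K) (SU N)} (hWms : Wms ∈ solvableDom (avOfRecord F N K) (regLFOfRecord F N ν K k) (genSet s.Ω k))
    (huniq : UniqueUkOrbit F N K k ν.εreg (Wms k)) (hhi : ν.εreg ≤ a₀) {δ : ℝ} (hδ : 0 < δ) (hδa : δ ≤ a₁)
    (hδε : B₃ * δ ≤ ν.εreg) (hreg : PlaqSmall δ (Wms k)) :
    PlaqSmall (B₃ * δ * (F.P K).eta k ^ 2) (UbgOfRecord F N ν M g K k s Wms) :=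
  plaqSmall_of_orbitRel (orbitRel_UbgOfRecord_Uk_of_top ν M g K k hk s hs hWms huniq).symm
    (plaqSmall_Uk_of_thm1_objects hT1 hUk hhi hδ hδa hδε hreg)

/-! ## §3. The (2.17)-type large-field side at the record's background -/

omit hT1 in
/-- **A LARGE BACKGROUND PLAQUETTE EXCLUDES THE JUNK BRANCH**: if `U_k(s)(𝐖)` has a plaquette with `|U_k(s)(𝐖)(∂p) − 1| ≥ θ > 0` then `𝐖` is
solvable (off the solvable set the background of record is the unit configuration, `UbgOfRecord_of_not_mem`, all of whose plaquette variables are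
`1`). [folklore] -/
theorem mem_solvableDom_of_large_plaquette (ν : Stage7Numerics) (M : ℕ) (g : ℕ → ℝ) (s : SeqOfRecord F ν M g K k)
    {Wms : MSField (F.P K) (SU N)} {θ : ℝ} (hθ : 0 < θ) {p : Plaq (F.P K) 0}
    (hp : θ ≤ dist1 (plaqHol (UbgOfRecord F N ν M g K k s Wms) p)) :
    Wms ∈ solvableDom (avOfRecord F N K) (regLFOfRecord F N ν K k) (genSet s.Ω k) := by
  by_contra h
  rw [UbgOfRecord_of_not_mem ν M g K k s h] at hp
  have h1 : plaqHol (fun _ => (1 : SU N) : GaugeField (F.P K) 0 (SU N)) p = 1 := by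
    simp [GaugeField.plaqHol]
  rw [h1, GaugeGroup.dist1_one] at hp
  linarith

/-- **THE (2.17)-TYPE SLOT AT THE RECORD's BACKGROUND, LARGE-FIELD SIDE (door A).**  If `U_k(s)(𝐖)` has a `θ`-large plaquette (`θ > 0`,
`B₃⁻¹η_k⁻²θ ≤ min a₁ (ν.εreg∕B₃)`) and lies in [B11] (2)'s space at `ν.εreg` (displayed reading; the solvability is automatic by
`mem_solvableDom_of_large_plaquette`), then the datum `𝐖_k` has a plaquette `p′` with `|𝐖_k(∂p′) − 1| ≥ B₃⁻¹η_k⁻²θ` — print's p. 193 second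
sentence read for the (2.17) slot of the record, modulo N07's slot. [folklore] -/
theorem exists_large_plaquette_of_UbgOfRecord_dev_ge (hB₃ : 0 < B₃) (ν : Stage7Numerics) (M : ℕ) (g : ℕ → ℝ) (hk : 1 ≤ k)
    (s : SeqOfRecord F ν M g K k) (hs : ∀ j, 1 ≤ j → j ≤ k → s.Ω j = Set.univ) (hhi : ν.εreg ≤ a₀) {Wms : MSField (F.P K) (SU N)}
    (hB11 : InUkClassB11 F N K k ν.εreg (UbgOfRecord F N ν M g K k s Wms)) {θ : ℝ} (hθ : 0 < θ)
    (hθw : B₃⁻¹ * ((F.P K).eta k ^ 2)⁻¹ * θ ≤ min a₁ (ν.εreg / B₃))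
    (hlarge : ∃ p : Plaq (F.P K) 0, θ ≤ dist1 (plaqHol (UbgOfRecord F N ν M g K k s Wms) p)) :
    ∃ p' : Plaq (F.P K) k, B₃⁻¹ * ((F.P K).eta k ^ 2)⁻¹ * θ ≤ dist1 (plaqHol (Wms k) p') := by
  obtain ⟨p, hp⟩ := hlarge
  have hWms := mem_solvableDom_of_large_plaquette ν M g s hθ hp
  have hη : 0 < (F.P K).eta k := eta_pos K k
  by_contra hcon
  push Not at hcon
  have hreg : PlaqSmall (B₃⁻¹ * ((F.P K).eta k ^ 2)⁻¹ * θ) (Wms k) := fun p' => hcon p'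
  have hδ : 0 < B₃⁻¹ * ((F.P K).eta k ^ 2)⁻¹ * θ := by positivity
  have hδa : B₃⁻¹ * ((F.P K).eta k ^ 2)⁻¹ * θ ≤ a₁ := hθw.trans (min_le_left _ _)
  have hδε : B₃ * (B₃⁻¹ * ((F.P K).eta k ^ 2)⁻¹ * θ) ≤ ν.εreg := by
    have h := hθw.trans (min_le_right _ _)
    rw [le_div_iff₀ hB₃] at h
    linarith
  have hsmall := plaqSmall_UbgOfRecord_top_of_thm1_objects hT1 ν M g hk s hs hWms hB11 hhi hδ hδa hδε hreg p
  have hB' : B₃ ≠ 0 := hB₃.ne'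
  have hη' : (F.P K).eta k ^ 2 ≠ 0 := by positivity
  have e : B₃ * (B₃⁻¹ * ((F.P K).eta k ^ 2)⁻¹ * θ) * (F.P K).eta k ^ 2 = θ := by field_simp
  rw [e] at hsmall
  exact absurd hp (not_le.2 hsmall)

/-- **… AND THE WILSON FACTOR** (*«estimating in the usual way the Wilson action»*, `G = SU(N)`, `|g − 1|² ≤ 2N(1 − Re tr g)`;
`B15Chi175LargeFieldFactor.exp_neg_wilsonLoc_le_of_large_plaquette` BY NAME): with a plaquette weight `ζ ≥ w` everywhere on `T^{(k)}`,
`exp(−A(ζ, 𝐖_k)) ≤ exp(−w·(2N)⁻¹·(B₃⁻¹η_k⁻²θ)²)`. [folklore] -/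
theorem exp_neg_wilsonLoc_le_of_UbgOfRecord_dev_ge (hB₃ : 0 < B₃) (ν : Stage7Numerics) (M : ℕ) (g : ℕ → ℝ) (hk : 1 ≤ k)
    (s : SeqOfRecord F ν M g K k) (hs : ∀ j, 1 ≤ j → j ≤ k → s.Ω j = Set.univ) (hhi : ν.εreg ≤ a₀) {Wms : MSField (F.P K) (SU N)}
    (hB11 : InUkClassB11 F N K k ν.εreg (UbgOfRecord F N ν M g K k s Wms)) {θ : ℝ} (hθ : 0 < θ)
    (hθw : B₃⁻¹ * ((F.P K).eta k ^ 2)⁻¹ * θ ≤ min a₁ (ν.εreg / B₃)) (ζ : Plaq (F.P K) k → ℝ) (hζ : ∀ p, 0 ≤ ζ p) {w : ℝ}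
    (hw : ∀ p, w ≤ ζ p) (hlarge : ∃ p : Plaq (F.P K) 0, θ ≤ dist1 (plaqHol (UbgOfRecord F N ν M g K k s Wms) p)) :
    Real.exp (-wilsonLoc ζ (Wms k)) ≤ Real.exp (-(w * ((2 * (N : ℝ))⁻¹ * (B₃⁻¹ * ((F.P K).eta k ^ 2)⁻¹ * θ) ^ 2))) := by
  obtain ⟨p', hp'⟩ := exists_large_plaquette_of_UbgOfRecord_dev_ge hT1 hB₃ ν M g hk s hs hhi hB11 hθ hθw hlarge
  have ha : 0 ≤ B₃⁻¹ * ((F.P K).eta k ^ 2)⁻¹ * θ := by have := eta_pos (F := F) K k; positivity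
  refine (exp_neg_wilsonLoc_le_of_large_plaquette hcmp_specialUnitaryGroup two_mul_N_pos ζ hζ ha hp').trans
    (Real.exp_le_exp.2 (neg_le_neg ?_))
  exact mul_le_mul_of_nonneg_right (hw p') (by positivity)

end Thm1Objects

end Summit.QuantumFields.YangMills.Theorems.N21RegularityTransferAtRecord

end
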